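import Summits.RiemannHypothesis.RiemannHypothesis.Theses.WeilComb
import Summits.RiemannHypothesis.RiemannHypothesis.Theorems.WeilCombCombShapeAdmissible
import Literature.NumberTheory.LFunctions.WeilExplicit
import Literature.NumberTheory.LFunctions.WeilExplicitArchTermProofs
import Literature.NumberTheory.LFunctions.WeilMellinBounds
import Literature.NumberTheory.LFunctions.WeilArchimedeanPositivityProofs

/-!
# Sub-goal `weilArchTerm_translate_psi_offdiag` of stub `stub_window` (line `Sketch`) for crux
`WeilComb.CombShapePositivity` (item stmt-RiemannHypothesis-11229, route route-RiemannHypothesis-WeilComb)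

The archimedean kernel of the fixed-shape comb OFF THE DIAGONAL, in Bombieri's form.
Notation: `φ₀(u) = expNegInvGlue (1 - u²)` (the route's fixed bump, a Weil test with
`tsupport φ₀ ⊆ [-1, 1]` by `weilComb_shapeBump_isWeilTest` / `weilComb_shapeBump_tsupport_subset`),
`φ_ε(t) = ε⁻¹ φ₀(t/ε)`, `ψ_ε = φ_ε ⋆ φ̃_ε` (`weilConv` / `weilReflect`),
`τ_x h = weilTranslate h x = h(· − x)`, `W_∞ = weilArchTerm`.

**Statement.** For `ε > 0` and `|x| > 2ε`, with `h := τ_x ψ_ε`,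
`W_∞(h) = −∫₀^∞ e^{t/2} (h(t) + h(−t)) / (2 sinh t) dt`.

**Proof.** `h` is a Weil test (dilates, reflections, convolutions and translates of tests are
tests), so Bombieri's form of the archimedean term applies
(`weilArchTermBombieri_eq_weilArchTerm_holds`):
`W_∞(h) = −((log 4π + γ) h(0) + ∫₀^∞ (e^{t/2}(h(t) + h(−t)) − 2 h(0)) / (2 sinh t) dt)`.
Since `tsupport φ_ε ⊆ [−ε, ε]`, `tsupport ψ_ε ⊆ [−2ε, 2ε]`
(`tsupport_weilConv_weilReflect_subset`), hence `h(0) = ψ_ε(−x) = 0` because `|−x| > 2ε`, and the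
two `h(0)`-terms drop out.
-/

noncomputable section

-- the sub-problem path RiemannHypothesis/RiemannHypothesis duplicates a namespace (D-0017)
set_option linter.dupNamespace false

open scoped BigOperators ComplexConjugate
open Complex MeasureTheory Set

namespace Summit.RiemannHypothesis.RiemannHypothesis.Theorems.WeilCombBohrFejer

open Literature.NumberTheory.LFunctions

/-- `φ_ε = ε⁻¹ φ(·/ε)` is a Weil test function for `ε ≠ 0` (smoothness of `t ↦ t/ε`; the support is
the image of a compact set under the homeomorphism `t ↦ ε t`). [folklore] -/
private theorem isWeilTest_dil_archOffdiag {φ : ℝ → ℂ} {ε : ℝ} (hφ : IsWeilTest φ) (hε : ε ≠ 0) :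
    IsWeilTest (fun t : ℝ => (ε : ℂ)⁻¹ * φ (t / ε)) := by
  -- adapted from `WeilCombSubcritical.isWeilTest_dil_offdiag` (private there)
  have h1 : IsWeilTest (fun t : ℝ => φ (t / ε)) := by
    refine ⟨hφ.1.comp (contDiff_id.div_const ε), ?_⟩
    have e : (fun t : ℝ => φ (t / ε)) = φ ∘ (Homeomorph.mulRight₀ ε⁻¹ (inv_ne_zero hε)) := by
      ext t
      simp [div_eq_mul_inv]
    rw [e]
    exact hφ.2.comp_homeomorph _
  exact h1.const_mul _

/-- `tsupport φ ⊆ [-1, 1]` gives `tsupport φ_ε ⊆ [-ε, ε]` (`ε > 0`). [folklore] -/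
private theorem tsupport_dil_subset_archOffdiag {φ : ℝ → ℂ} {ε : ℝ}
    (hsupp : tsupport φ ⊆ Icc (-1) 1) (hε : 0 < ε) :
    tsupport (fun t : ℝ => (ε : ℂ)⁻¹ * φ (t / ε)) ⊆ Icc (-ε) ε := by
  -- adapted from `WeilCombSubcritical.tsupport_dil_subset_offdiag` (private there)
  refine closure_minimal ?_ isClosed_Icc
  intro t ht
  rw [Function.mem_support] at ht
  have hφ : φ (t / ε) ≠ 0 := fun h => ht (by simp [h])
  have hmem : t / ε ∈ Icc (-1 : ℝ) 1 := hsupp (subset_tsupport _ hφ)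
  constructor
  · have h := hmem.1
    rw [le_div_iff₀ hε] at h
    linarith
  · have h := hmem.2
    rw [div_le_iff₀ hε] at h
    linarith

/-- `ψ_ε(s) = 0` for `|s| > 2ε`: `tsupport ψ_ε ⊆ [-2ε, 2ε]`. [folklore] -/
private theorem psi_eq_zero_archOffdiag {φ : ℝ → ℂ} {ε : ℝ} (hφ : IsWeilTest φ)
    (hsupp : tsupport φ ⊆ Icc (-1) 1) (hε : 0 < ε) {s : ℝ} (hs : 2 * ε < |s|) :
    weilConv (fun t : ℝ => (ε : ℂ)⁻¹ * φ (t / ε))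
        (weilReflect (fun t : ℝ => (ε : ℂ)⁻¹ * φ (t / ε))) s = 0 := by
  have hsub : tsupport (weilConv (fun t : ℝ => (ε : ℂ)⁻¹ * φ (t / ε))
      (weilReflect (fun t : ℝ => (ε : ℂ)⁻¹ * φ (t / ε)))) ⊆ Icc (-(2 * ε)) (2 * ε) :=
    tsupport_weilConv_weilReflect_subset (isWeilTest_dil_archOffdiag hφ hε.ne').2
      (tsupport_dil_subset_archOffdiag hsupp hε)
  refine image_eq_zero_of_notMem_tsupport fun h => ?_
  have h1 := (hsub h).1
  have h2 := (hsub h).2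
  have : |s| ≤ 2 * ε := abs_le.2 ⟨h1, h2⟩
  linarith

/-- **Sub-goal (c) of `stub_window`: the arch kernel off the diagonal.** For `ε > 0` and
`|x| > 2ε`, the archimedean term of `h = τ_x ψ_ε` is Bombieri's integral without its
`h(0)`-terms: `W_∞(h) = −∫₀^∞ e^{t/2} (h(t) + h(−t)) / (2 sinh t) dt`
(`weilArchTermBombieri_eq_weilArchTerm_holds` and `h(0) = ψ_ε(−x) = 0` since
`tsupport ψ_ε ⊆ [−2ε, 2ε]`). [folklore] -/
theorem weilArchTerm_translate_psi_offdiag : ∀ ε : ℝ, 0 < ε → ∀ x : ℝ, 2 * ε < |x| →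
    weilArchTerm (weilTranslate
        (weilConv (fun t : ℝ => (ε : ℂ)⁻¹ * ((expNegInvGlue (1 - (t / ε) ^ 2) : ℝ) : ℂ))
          (weilReflect (fun t : ℝ => (ε : ℂ)⁻¹ * ((expNegInvGlue (1 - (t / ε) ^ 2) : ℝ) : ℂ)))) x) =
      -∫ t in Set.Ioi (0 : ℝ), (Real.exp (t / 2) : ℂ) *
          (weilTranslate
              (weilConv (fun t : ℝ => (ε : ℂ)⁻¹ * ((expNegInvGlue (1 - (t / ε) ^ 2) : ℝ) : ℂ))
                (weilReflect (fun t : ℝ => (ε : ℂ)⁻¹ * ((expNegInvGlue (1 - (t / ε) ^ 2) : ℝ) : ℂ)))) x t +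
            weilTranslate
              (weilConv (fun t : ℝ => (ε : ℂ)⁻¹ * ((expNegInvGlue (1 - (t / ε) ^ 2) : ℝ) : ℂ))
                (weilReflect (fun t : ℝ => (ε : ℂ)⁻¹ * ((expNegInvGlue (1 - (t / ε) ^ 2) : ℝ) : ℂ)))) x (-t)) /
          (2 * Real.sinh t : ℂ) := by
  intro ε hε x hx
  -- the fixed bump `φ₀` and its admissibility
  have hφ₀W : IsWeilTest (fun u : ℝ => ((expNegInvGlue (1 - u ^ 2) : ℝ) : ℂ)) :=
    weilComb_shapeBump_isWeilTest
  have hφ₀supp : tsupport (fun u : ℝ => ((expNegInvGlue (1 - u ^ 2) : ℝ) : ℂ)) ⊆ Icc (-1) 1 :=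
    weilComb_shapeBump_tsupport_subset
  -- notation
  set φε : ℝ → ℂ := fun t : ℝ => (ε : ℂ)⁻¹ * ((expNegInvGlue (1 - (t / ε) ^ 2) : ℝ) : ℂ) with hφε
  set ψ : ℝ → ℂ := weilConv φε (weilReflect φε) with hψ
  set h : ℝ → ℂ := weilTranslate ψ x with hh
  -- `h` is a Weil test
  have hφεW : IsWeilTest φε :=
    isWeilTest_dil_archOffdiag (φ := fun u : ℝ => ((expNegInvGlue (1 - u ^ 2) : ℝ) : ℂ))
      hφ₀W hε.ne'
  have hψW : IsWeilTest ψ := hφεW.weilConv hφεW.weilReflect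
  have hhW : IsWeilTest h := hψW.weilTranslate x
  -- `h 0 = ψ_ε(-x) = 0`
  have hh0 : h 0 = 0 := by
    have hs : 2 * ε < |(0 : ℝ) - x| := by rwa [zero_sub, abs_neg]
    exact psi_eq_zero_archOffdiag (φ := fun u : ℝ => ((expNegInvGlue (1 - u ^ 2) : ℝ) : ℂ))
      hφ₀W hφ₀supp hε hs
  -- Bombieri's form with `h 0 = 0`
  rw [← weilArchTermBombieri_eq_weilArchTerm_holds hhW, weilArchTermBombieri_eq, hh0]
  simp

end Summit.RiemannHypothesis.RiemannHypothesis.Theorems.WeilCombBohrFejer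

end
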